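import Summits.QuantumFields.YangMills.Theorems.UnitScaleTiltProp7FaceFlux
import HarnessLib

/-!
# Route `UnitScaleTilt`, crux K1 «MinimiserStabilityRegPr» (stmt-QuantumFields-19200), line «route-R», stub P `stub_relPoincareOpt` — P-lin-flat step N5 (CARD-19200-V3-g11 §2),
# SECOND HALF: THE FACE IS ONE LAYER (count `(L^e)^{d−1}`, layer form of (i)–(ii) unconditional) AND N5 (iii): STRAIGHT-LINE BLOCK MEAN VERSUS FACE MEAN

Cell `ym3-torus`, width seat `ym-ust-20520-w2` (g2).  THEOREMS ONLY (0 `def`, 0 `sorry`); `--supports stmt-QuantumFields-19200`, count-neutral.  Continues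
`…Theorems.UnitScaleTiltProp7FaceFlux` (§1–§4: `proj_shift_of_dvd/of_not_dvd`, exact orthogonality `sum_faceFlux_mul_coarseGrad_eq_zero`, `faceFlux_coclosed`) in the
same letters (`h : P.sitesPerDir i = P.L ^ e * P.sitesPerDir i'`, `Site.proj i' e`, `LatticeFieldCalculus.diverg`), all sets written as explicit `univ.filter` terms.
YM₃ on T³ is a ladder rung (R3), not the Clay problem; nothing here claims P, the stub, the crux or the gap.

WHAT IS PROVED (ns `…Theorems.Prop7FaceFluxLineMean`).  §5: ★ `proj_shift_eq_shift_iff` (≥ 2 coarse sites per direction: `proj (x+e_μ) = proj x + e_μ ↔ L^e ∣ x_μ+1`),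
★ `faceFilter_eq_layer` (the face of §3–§4 = the last layer `{proj x = y ∧ x_μ % L^e + 1 = L^e}`), ★ `card_faceLayer` (`= (L^e)^{d−1}`, `e`-level twin of
`B10StarCount.card_block_filter_top`), ★ `sum_faceLayer_mul_coarseGrad_eq_zero` / ★ `faceLayer_coclosed` (N5 (ii)/(i) for the layer face, NO hypothesis on the coarse
torus).  §6: ★★ `sq_lineMean_sub_faceMean_le` — for EVERY real bond field `B` (no divergence condition), `y`, `μ` (`ℓ = L^e`, `V = ℓ^d`):
`((Vℓ)⁻¹ Σ_{x ∈ B^e(y)} Σ_{t<ℓ} B(x+t e_μ, μ) − ℓV⁻¹ Σ_{face} B)² ≤ ℓV⁻¹ Σ_{x ∈ B^e(y)} Σ_{s<ℓ} (B(x+(s+1)e_μ, μ) − B(x+s e_μ, μ))²` (the first term is ★p1's explicit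
straight-line block mean `M_e` of `Prop7FlatCoercivity`; each line crosses the face once, telescoping, Cauchy–Schwarz twice); ★★ `sum_sq_lineMean_sub_faceMean_le` —
summed over coarse bonds: `Σ_c (M_eB(c) − ℓV⁻¹·FS B c)² ≤ ℓ²V⁻¹ · Σ_μ Σ_x (B(x+e_μ, μ) − B(x, μ))²` (`ℓ^{2−d}`; at `d = 3` the CARD's factor `ℓ^{−1}`, constant 1).
HONEST SCOPE.  Linear flat abelian lattice bookkeeping ([folklore]); the two-block LOCAL form of (iii) and the assembly N7 are not typed here.

References: T. Bałaban, CMP 95 (1984) 17–40 [Balaban1984PropagatorsI] ((1.18)–(1.21) pp.20–21, Prop. 1.1 (1.90) p.33); CMP 102 (1985) 277–309 [Balaban1985Variational] (Prop. 7).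
-/

noncomputable section

open scoped BigOperators

namespace Summit.QuantumFields.YangMills.Theorems.Prop7FaceFluxLineMean

open Literature.MathematicalPhysics.QuantumFieldTheory.Balaban1983to89
open Finset LatticeFieldCalculus
open B10StarCount (sum_pbond unshift_shift shift_unshift shift_apply_self shift_apply_ne)
open Summit.QuantumFields.YangMills.Theorems.Prop7FaceFlux
open Summit.QuantumFields.YangMills.Theorems.Prop7FlatCoercivity (sum_shift sum_iterShift)

variable {P : Params} {i i' e : ℕ}


/-! ## §5 The face is one layer: residue description, count, and the layer form of (i)–(ii) (unconditional in the coarse torus) -/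

/-- The label of `x + e_μ` modulo `ℓ = L^e`: `((x + e_μ)_μ) % ℓ = (x_μ + 1) % ℓ` (the fine period `N = ℓ·N′` is a multiple of `ℓ`). [folklore] -/
theorem val_shift_mod (h : P.sitesPerDir i = P.L ^ e * P.sitesPerDir i') (x : Site P i) (μ : Fin P.d) :
    ((x.shift μ) μ).val % P.L ^ e = ((x μ).val + 1) % P.L ^ e := by
  rw [shift_apply_self_eq_natCast, ZMod.val_natCast]
  have h1 : ((x μ).val + 1) % P.sitesPerDir i % P.L ^ e = ((x μ).val + 1) % (P.L ^ e * P.sitesPerDir i') % P.L ^ e :=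
    congrArg (fun n => ((x μ).val + 1) % n % P.L ^ e) h
  rw [h1, Nat.mod_mul_right_mod]

/-- Successor modulo `ℓ`: `(v + 1) % ℓ = 0` on the last residue, `v % ℓ + 1` otherwise. [folklore] -/
theorem succ_mod_eq {ℓ : ℕ} (hℓ : 0 < ℓ) (v : ℕ) : (v + 1) % ℓ = if v % ℓ + 1 = ℓ then 0 else v % ℓ + 1 := by
  have hdm := Nat.div_add_mod v ℓ; have hlt := Nat.mod_lt v hℓ
  split_ifs with htop
  · have hv : v + 1 = ℓ * (v / ℓ + 1) := by rw [mul_add, mul_one]; omega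
    rw [hv, Nat.mul_mod_right]
  · have hv : v + 1 = ℓ * (v / ℓ) + (v % ℓ + 1) := by omega
    rw [hv, Nat.mul_add_mod, Nat.mod_eq_of_lt (by omega)]

/-- ★ **THE FACE TEST IN RESIDUE FORM** (coarse torus with at least two sites per direction): `proj (x + e_μ) = proj x + e_μ ↔ L^e ∣ x_μ + 1`. [folklore] -/
theorem proj_shift_eq_shift_iff (h : P.sitesPerDir i = P.L ^ e * P.sitesPerDir i') (hN' : 1 < P.sitesPerDir i') (x : Site P i) (μ : Fin P.d) :
    Site.proj i' e (x.shift μ) = (Site.proj i' e x).shift μ ↔ P.L ^ e ∣ (x μ).val + 1 := by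
  refine ⟨fun hx => ?_, proj_shift_of_dvd h x μ⟩
  by_contra hdvd
  rw [proj_shift_of_not_dvd h x μ hdvd] at hx
  have h2 := congrFun hx μ  -- `y = y + e_μ` is impossible on a torus with ≥ 2 sites per direction
  rw [shift_apply_self] at h2
  haveI : Fact (1 < P.sitesPerDir i') := ⟨hN'⟩
  have h3 : (1 : ZMod (P.sitesPerDir i')) = 0 := by
    calc (1 : ZMod (P.sitesPerDir i')) = (Site.proj i' e x μ + 1) - Site.proj i' e x μ := by ring
      _ = 0 := by rw [← h2, sub_self]
  have h4 := congrArg ZMod.val h3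
  rw [ZMod.val_one, ZMod.val_zero] at h4
  exact one_ne_zero h4

/-- ★ **THE FACE IS THE LAST LAYER** (≥ 2 coarse sites per direction): `{x : proj x = y ∧ proj (x + e_μ) = y + e_μ} = {x : proj x = y ∧ x_μ % L^e + 1 = L^e}`. [folklore] -/
theorem faceFilter_eq_layer (h : P.sitesPerDir i = P.L ^ e * P.sitesPerDir i') (hN' : 1 < P.sitesPerDir i') (μ : Fin P.d) (y : Site P i') :
    univ.filter (fun x : Site P i => Site.proj i' e x = y ∧ Site.proj i' e (x.shift μ) = y.shift μ)
      = univ.filter (fun x : Site P i => Site.proj i' e x = y ∧ (x μ).val % P.L ^ e + 1 = P.L ^ e) := by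
  classical
  refine Finset.filter_congr fun x _ => ?_
  constructor
  · rintro ⟨hx, hx'⟩
    exact ⟨hx, (dvd_succ_iff_mod_succ_eq (pow_pos P.L_pos e) _).1 ((proj_shift_eq_shift_iff h hN' x μ).1 (by rw [hx', hx]))⟩
  · rintro ⟨hx, hx'⟩
    exact ⟨hx, by rw [proj_shift_of_dvd h x μ ((dvd_succ_iff_mod_succ_eq (pow_pos P.L_pos e) _).2 hx'), hx]⟩

/-- A sum over the block `B^e(y)` is a sum over the offsets `{0,…,L^e − 1}^d` (`B1RG242Torus.fibreEquiv`; the `e`-level twin of `B10StarCount.sum_block`). [folklore] -/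
theorem sum_fibre_eq_sum_offsets (h : P.sitesPerDir i = P.L ^ e * P.sitesPerDir i') (y : Site P i') {M : Type*} [AddCommMonoid M]
    (F : Site P i → M) :
    ∑ x ∈ univ.filter (fun x : Site P i => Site.proj i' e x = y), F x = ∑ r : Fin P.d → Fin (P.L ^ e), F (Site.fibreSite i e y r) := by
  classical
  rw [Finset.sum_subtype (univ.filter (fun x : Site P i => Site.proj i' e x = y)) (p := fun x : Site P i => Site.proj i' e x = y)
    (fun x => by simp only [Finset.mem_filter, Finset.mem_univ, true_and])]
  refine Fintype.sum_equiv (Site.fibreEquiv h y) _ _ fun a => ?_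
  exact (congrArg (fun z : {x : Site P i // Site.proj i' e x = y} => F z.1) ((Site.fibreEquiv h y).symm_apply_apply a)).symm

/-- ★ **THE FACE HAS `(L^e)^{d−1}` SITES**: `#{x : proj x = y ∧ x_μ % L^e + 1 = L^e} = (L^e)^{d−1}` (the `e`-level twin of `B10StarCount.card_block_filter_top`). [folklore] -/
theorem card_faceLayer (h : P.sitesPerDir i = P.L ^ e * P.sitesPerDir i') (y : Site P i') (μ : Fin P.d) :
    (univ.filter (fun x : Site P i => Site.proj i' e x = y ∧ (x μ).val % P.L ^ e + 1 = P.L ^ e)).card = (P.L ^ e) ^ (P.d - 1) := by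
  classical
  have hℓ : 0 < P.L ^ e := pow_pos P.L_pos e
  let top : Fin (P.L ^ e) := ⟨P.L ^ e - 1, Nat.sub_lt hℓ Nat.one_pos⟩
  rw [← Finset.filter_filter, Finset.card_filter, sum_fibre_eq_sum_offsets h y]
  have hiff : ∀ r : Fin P.d → Fin (P.L ^ e), (((Site.fibreSite i e y r) μ).val % P.L ^ e + 1 = P.L ^ e) ↔ r μ = top := by
    intro r
    rw [Site.val_fibreSite h, Nat.mul_add_mod_of_lt (r μ).isLt, Fin.ext_iff]
    show (r μ : ℕ) + 1 = P.L ^ e ↔ (r μ : ℕ) = P.L ^ e - 1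
    omega
  simp_rw [hiff]
  rw [← Finset.card_filter]
  have hc := Fintype.card_filter_piFinset_const_eq_of_mem (univ : Finset (Fin (P.L ^ e))) μ (mem_univ top)
  rw [Fintype.piFinset_univ, card_univ, Fintype.card_fin, Fintype.card_fin] at hc
  exact hc

/-- On a coarse torus with ONE site per direction all coarse sites coincide. [folklore] -/
theorem coarse_subsingleton (hN' : P.sitesPerDir i' = 1) : Subsingleton (Site P i') := by
  haveI : Subsingleton (ZMod (P.sitesPerDir i')) := (ZMod.subsingleton_iff).2 hN'
  show Subsingleton (Fin P.d → ZMod (P.sitesPerDir i'))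
  infer_instance

/-- ★ **N5 (ii), LAYER FORM, UNCONDITIONAL**: `Σ_c (g(c₊) − g(c₋))·Σ_{x ∈ B^e(c₋), x_μ % L^e + 1 = L^e} B(x, μ) = 0` for `∂^*B = 0` and every coarse `g`
(§3 through `faceFilter_eq_layer`; for one coarse site per direction every coarse gradient vanishes). [cite: Balaban1984PropagatorsI, (1.21) p.21] -/
theorem sum_faceLayer_mul_coarseGrad_eq_zero (h : P.sitesPerDir i = P.L ^ e * P.sitesPerDir i') {c₀ : ℝ} (hc₀ : c₀ ≠ 0)
    {B : PBond P i → ℝ} (hB : diverg c₀ B = 0) (g : Site P i' → ℝ) :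
    ∑ c : PBond P i', (g c.tgt - g c.src) *
        ∑ x ∈ univ.filter (fun x : Site P i => Site.proj i' e x = c.src ∧ (x c.dir).val % P.L ^ e + 1 = P.L ^ e), B ⟨x, c.dir⟩ = 0 := by
  classical
  by_cases hN' : 1 < P.sitesPerDir i'
  · rw [← sum_faceFlux_mul_coarseGrad_eq_zero h hc₀ hB g]
    refine Finset.sum_congr rfl fun c _ => ?_
    rw [show c.tgt = c.src.shift c.dir from rfl, faceFilter_eq_layer h hN' c.dir c.src]
  · have h1 : P.sitesPerDir i' = 1 := by
      have := Nat.pos_of_ne_zero (P.sitesPerDir_ne_zero i'); omega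
    haveI := coarse_subsingleton (P := P) h1
    refine Finset.sum_eq_zero fun c _ => ?_
    rw [Subsingleton.elim c.tgt c.src, sub_self, zero_mul]

/-- ★ **N5 (i), LAYER FORM, UNCONDITIONAL**: the layer face flux `c ↦ Σ_{x ∈ B^e(c₋), x_μ % L^e + 1 = L^e} B(x, c.dir)` of a divergence-free `B` is co-closed
on the coarse torus. [cite: Balaban1984PropagatorsI, (1.21) p.21] -/
theorem faceLayer_coclosed (h : P.sitesPerDir i = P.L ^ e * P.sitesPerDir i') {c₀ : ℝ} (hc₀ : c₀ ≠ 0)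
    {B : PBond P i → ℝ} (hB : diverg c₀ B = 0) (c' : ℝ) (y : Site P i') :
    diverg c' (fun c : PBond P i' =>
      ∑ x ∈ univ.filter (fun x : Site P i => Site.proj i' e x = c.src ∧ (x c.dir).val % P.L ^ e + 1 = P.L ^ e), B ⟨x, c.dir⟩) y = 0 := by
  classical
  by_cases hN' : 1 < P.sitesPerDir i'
  · have hfun : (fun c : PBond P i' =>
          ∑ x ∈ univ.filter (fun x : Site P i => Site.proj i' e x = c.src ∧ (x c.dir).val % P.L ^ e + 1 = P.L ^ e), B ⟨x, c.dir⟩)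
        = (fun c : PBond P i' =>
          ∑ x ∈ univ.filter (fun x : Site P i => Site.proj i' e x = c.src ∧ Site.proj i' e (x.shift c.dir) = c.tgt), B ⟨x, c.dir⟩) := by
      funext c
      rw [show c.tgt = c.src.shift c.dir from rfl, faceFilter_eq_layer h hN' c.dir c.src]
    rw [hfun]
    exact faceFlux_coclosed h hc₀ hB c' y
  · have h1 : P.sitesPerDir i' = 1 := by
      have := Nat.pos_of_ne_zero (P.sitesPerDir_ne_zero i'); omega
    haveI := coarse_subsingleton (P := P) h1
    simp only [diverg]
    refine Finset.sum_eq_zero fun μ _ => ?_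
    rw [Subsingleton.elim (y.unshift μ) y, sub_self, smul_zero]

/-! ## §6 N5 (iii): the straight-line block mean versus the face mean
(`(M_eX)(⟨y, μ⟩) := (((L^e)^d·L^e)⁻¹)·Σ_{x : proj x = y} Σ_{t < L^e} X ⟨(·.shift μ)^[t] x, μ⟩` as in ★p1's `Prop7FlatCoercivity` §1; the LAYERS of the block are
`{x : proj x = y ∧ x_μ % L^e = j}`, `j < L^e`, the face being the last one) -/

/-- One step up inside the block: `x ↦ x + e_μ` maps the layer `j` of `B^e(y)` onto the layer `j + 1` (`j + 1 < L^e`) — membership form. [folklore] -/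
theorem shift_mem_layer_iff (h : P.sitesPerDir i = P.L ^ e * P.sitesPerDir i') {μ : Fin P.d} {j : ℕ} (hj : j + 1 < P.L ^ e)
    (y : Site P i') (w : Site P i) :
    (Site.proj i' e (w.shift μ) = y ∧ ((w.shift μ) μ).val % P.L ^ e = j + 1) ↔ (Site.proj i' e w = y ∧ (w μ).val % P.L ^ e = j) := by
  have hℓ : 0 < P.L ^ e := pow_pos P.L_pos e
  rw [val_shift_mod h, succ_mod_eq hℓ]
  by_cases htop : (w μ).val % P.L ^ e + 1 = P.L ^ e
  · rw [if_pos htop]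
    exact ⟨fun ⟨_, h2⟩ => by omega, fun ⟨_, h2⟩ => by omega⟩
  · rw [if_neg htop, proj_shift_of_not_dvd h w μ (fun hd => htop ((dvd_succ_iff_mod_succ_eq hℓ _).1 hd))]
    exact ⟨fun ⟨h1, h2⟩ => ⟨h1, by omega⟩, fun ⟨h1, h2⟩ => ⟨h1, by omega⟩⟩

/-- One step up inside the block, as sums: `Σ_{x ∈ layer j} F(x + e_μ) = Σ_{x ∈ layer (j+1)} F(x)` (`j + 1 < L^e`). [folklore] -/
theorem sum_layer_shift (h : P.sitesPerDir i = P.L ^ e * P.sitesPerDir i') {μ : Fin P.d} {j : ℕ} (hj : j + 1 < P.L ^ e)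
    (y : Site P i') (F : Site P i → ℝ) :
    ∑ x ∈ univ.filter (fun x : Site P i => Site.proj i' e x = y ∧ (x μ).val % P.L ^ e = j), F (x.shift μ)
      = ∑ x ∈ univ.filter (fun x : Site P i => Site.proj i' e x = y ∧ (x μ).val % P.L ^ e = j + 1), F x := by
  classical
  rw [Finset.sum_filter, Finset.sum_filter]
  rw [← sum_shift μ (fun z : Site P i => if Site.proj i' e z = y ∧ (z μ).val % P.L ^ e = j + 1 then F z else 0)]
  refine Finset.sum_congr rfl fun x _ => ?_
  simp only [shift_mem_layer_iff h hj y x]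

/-- `s` steps up inside the block: `Σ_{x ∈ layer j} F(x + s·e_μ) = Σ_{x ∈ layer (j+s)} F(x)` (`j + s < L^e`). [folklore] -/
theorem sum_layer_iterShift (h : P.sitesPerDir i = P.L ^ e * P.sitesPerDir i') {μ : Fin P.d} (y : Site P i') (F : Site P i → ℝ) :
    ∀ (s j : ℕ), j + s < P.L ^ e →
      ∑ x ∈ univ.filter (fun x : Site P i => Site.proj i' e x = y ∧ (x μ).val % P.L ^ e = j), F ((fun z : Site P i => z.shift μ)^[s] x)
        = ∑ x ∈ univ.filter (fun x : Site P i => Site.proj i' e x = y ∧ (x μ).val % P.L ^ e = j + s), F x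
  | 0, j, _ => by simp only [Function.iterate_zero, id_eq, add_zero]
  | s + 1, j, hjs => by
      have h1 : ∀ x : Site P i, F ((fun z : Site P i => z.shift μ)^[s + 1] x)
          = (fun w : Site P i => F ((fun z : Site P i => z.shift μ)^[s] w)) (x.shift μ) := fun x => by
        simp only [Function.iterate_succ_apply]
      rw [Finset.sum_congr rfl (fun x _ => h1 x),
        sum_layer_shift h (by omega) y (fun w : Site P i => F ((fun z : Site P i => z.shift μ)^[s] w)),
        sum_layer_iterShift h y F s (j + 1) (by omega), show j + 1 + s = j + (s + 1) by omega]

/-- The block is the disjoint union of its `L^e` layers in direction `μ`. [folklore] -/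
theorem sum_fibre_eq_sum_layers (μ : Fin P.d) (y : Site P i') {M : Type*} [AddCommMonoid M] (F : Site P i → M) :
    ∑ x ∈ univ.filter (fun x : Site P i => Site.proj i' e x = y), F x
      = ∑ j ∈ range (P.L ^ e), ∑ x ∈ univ.filter (fun x : Site P i => Site.proj i' e x = y ∧ (x μ).val % P.L ^ e = j), F x := by
  classical
  have hℓ : 0 < P.L ^ e := pow_pos P.L_pos e
  rw [← Finset.sum_fiberwise_of_maps_to (s := univ.filter (fun x : Site P i => Site.proj i' e x = y)) (t := range (P.L ^ e))
    (g := fun x : Site P i => (x μ).val % P.L ^ e) (fun x _ => mem_range.2 (Nat.mod_lt _ hℓ)) F]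
  refine Finset.sum_congr rfl fun j _ => ?_
  rw [Finset.filter_filter]

/-- Telescoping along the straight line: `f(x + n e_μ) = f(x) + Σ_{s<n} (f(x + (s+1)e_μ) − f(x + s e_μ))`. [folklore] -/
theorem apply_iterShift_eq_add_sum (μ : Fin P.d) (f : Site P i → ℝ) (x : Site P i) (n : ℕ) :
    f ((fun z : Site P i => z.shift μ)^[n] x)
      = f x + ∑ s ∈ range n, (f (((fun z : Site P i => z.shift μ)^[s] x).shift μ) - f ((fun z : Site P i => z.shift μ)^[s] x)) := by
  induction n with
  | zero => simp
  | succ n ih =>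
    rw [Finset.sum_range_succ, ← add_assoc, ← ih, Function.iterate_succ_apply']
    ring

/-- Two partial sums of the same sequence differ by at most the sum of the absolute values. [folklore] -/
theorem abs_partialSum_sub_le (a : ℕ → ℝ) {t t' n : ℕ} (ht : t ≤ n) (ht' : t' ≤ n) :
    |∑ s ∈ range t, a s - ∑ s ∈ range t', a s| ≤ ∑ s ∈ range n, |a s| := by
  wlog htt : t' ≤ t generalizing t t'
  · rw [abs_sub_comm]; exact this ht' ht (Nat.le_of_not_le htt)
  rw [← Finset.sum_Ico_eq_sub _ htt]
  calc |∑ s ∈ Ico t' t, a s| ≤ ∑ s ∈ Ico t' t, |a s| := abs_sum_le_sum_abs _ _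
    _ ≤ ∑ s ∈ range n, |a s| := by
        refine Finset.sum_le_sum_of_subset_of_nonneg (fun s hs => ?_) (fun _ _ _ => abs_nonneg _)
        rw [mem_Ico] at hs
        exact mem_range.2 (by omega)

/-- Two bonds of the same straight line of length `n` differ by at most the line's total variation:
`|f(x + t e_μ) − f(x + t′ e_μ)| ≤ Σ_{s<n} |f(x + (s+1)e_μ) − f(x + s e_μ)|` (`t, t′ ≤ n`). [folklore] -/
theorem abs_apply_iterShift_sub_le (μ : Fin P.d) (f : Site P i → ℝ) (x : Site P i) {t t' n : ℕ} (ht : t ≤ n) (ht' : t' ≤ n) :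
    |f ((fun z : Site P i => z.shift μ)^[t] x) - f ((fun z : Site P i => z.shift μ)^[t'] x)|
      ≤ ∑ s ∈ range n, |f (((fun z : Site P i => z.shift μ)^[s] x).shift μ) - f ((fun z : Site P i => z.shift μ)^[s] x)| := by
  rw [apply_iterShift_eq_add_sum μ f x t, apply_iterShift_eq_add_sum μ f x t', add_sub_add_left_eq_sub]
  exact abs_partialSum_sub_le _ ht ht'

/-- ★ **EACH STRAIGHT LINE CROSSES THE FACE EXACTLY ONCE**: evaluating, for every `x ∈ B^e(y)`, the bond of its `μ`-line lying on the face (`L^e − 1 − x_μ % L^e`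
steps up) and summing over the block gives `L^e` times the face sum. [folklore] -/
theorem sum_fibre_faceValue_eq (h : P.sitesPerDir i = P.L ^ e * P.sitesPerDir i') (μ : Fin P.d) (y : Site P i') (f : Site P i → ℝ) :
    ∑ x ∈ univ.filter (fun x : Site P i => Site.proj i' e x = y), f ((fun z : Site P i => z.shift μ)^[P.L ^ e - 1 - (x μ).val % P.L ^ e] x)
      = (P.L : ℝ) ^ e * ∑ x ∈ univ.filter (fun x : Site P i => Site.proj i' e x = y ∧ (x μ).val % P.L ^ e + 1 = P.L ^ e), f x := by
  classical
  have hℓ : 0 < P.L ^ e := pow_pos P.L_pos e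
  rw [sum_fibre_eq_sum_layers μ y]
  have hlay : ∀ j ∈ range (P.L ^ e),
      ∑ x ∈ univ.filter (fun x : Site P i => Site.proj i' e x = y ∧ (x μ).val % P.L ^ e = j),
          f ((fun z : Site P i => z.shift μ)^[P.L ^ e - 1 - (x μ).val % P.L ^ e] x)
        = ∑ x ∈ univ.filter (fun x : Site P i => Site.proj i' e x = y ∧ (x μ).val % P.L ^ e + 1 = P.L ^ e), f x := by
    intro j hj
    rw [mem_range] at hj
    have h1 : ∑ x ∈ univ.filter (fun x : Site P i => Site.proj i' e x = y ∧ (x μ).val % P.L ^ e = j),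
          f ((fun z : Site P i => z.shift μ)^[P.L ^ e - 1 - (x μ).val % P.L ^ e] x)
        = ∑ x ∈ univ.filter (fun x : Site P i => Site.proj i' e x = y ∧ (x μ).val % P.L ^ e = j),
          f ((fun z : Site P i => z.shift μ)^[P.L ^ e - 1 - j] x) := by
      refine Finset.sum_congr rfl fun x hx => ?_
      rw [(Finset.mem_filter.1 hx).2.2]
    rw [h1, sum_layer_iterShift h y f (P.L ^ e - 1 - j) j (by omega)]
    refine Finset.sum_congr (Finset.filter_congr fun x _ => ?_) fun _ _ => rfl
    exact ⟨fun ⟨hx, hx'⟩ => ⟨hx, by omega⟩, fun ⟨hx, hx'⟩ => ⟨hx, by omega⟩⟩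
  rw [Finset.sum_congr rfl hlay, Finset.sum_const, card_range, nsmul_eq_mul]
  push_cast
  ring

/-- The real-algebra step of (iii). [folklore] -/
theorem sq_lineMean_sub_faceMean_le_aux {V ℓ A FS G S : ℝ} (hV : 0 < V) (hℓ : 0 < ℓ)
    (hAG : |A - ℓ ^ 2 * FS| ≤ ℓ * G) (hG : G ^ 2 ≤ V * ℓ * S) :
    ((V * ℓ)⁻¹ * A - ℓ * V⁻¹ * FS) ^ 2 ≤ ℓ * V⁻¹ * S := by
  have hE : (V * ℓ)⁻¹ * A - ℓ * V⁻¹ * FS = (V * ℓ)⁻¹ * (A - ℓ ^ 2 * FS) := by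
    have h2 : (V * ℓ)⁻¹ * (ℓ ^ 2 * FS) = ℓ * V⁻¹ * FS := by
      rw [mul_inv, pow_two]
      calc V⁻¹ * ℓ⁻¹ * (ℓ * ℓ * FS) = (ℓ⁻¹ * ℓ) * (ℓ * V⁻¹ * FS) := by ring
        _ = ℓ * V⁻¹ * FS := by rw [inv_mul_cancel₀ hℓ.ne', one_mul]
    rw [mul_sub, h2]
  have h1 : (A - ℓ ^ 2 * FS) ^ 2 ≤ (ℓ * G) ^ 2 := by
    rw [← sq_abs (A - _)]
    exact pow_le_pow_left₀ (abs_nonneg _) hAG 2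
  rw [hE, mul_pow]
  calc ((V * ℓ)⁻¹) ^ 2 * (A - ℓ ^ 2 * FS) ^ 2 ≤ ((V * ℓ)⁻¹) ^ 2 * (ℓ * G) ^ 2 := mul_le_mul_of_nonneg_left h1 (sq_nonneg _)
    _ = ((V * ℓ)⁻¹) ^ 2 * ℓ ^ 2 * G ^ 2 := by ring
    _ ≤ ((V * ℓ)⁻¹) ^ 2 * ℓ ^ 2 * (V * ℓ * S) := mul_le_mul_of_nonneg_left hG (by positivity)
    _ = ℓ * V⁻¹ * S := by field_simp

/-- ★★ **N5 (iii): THE STRAIGHT-LINE BLOCK MEAN VERSUS THE FACE MEAN, ONE COARSE BOND.**  For every real bond field `B`, coarse site `y` and direction `μ`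
(`ℓ = L^e`, `V = ℓ^d = |B^e(y)|`):
`((Vℓ)⁻¹ Σ_{x ∈ B^e(y)} Σ_{t<ℓ} B(x + t e_μ, μ) − ℓ V⁻¹ Σ_{x ∈ face} B(x, μ))² ≤ ℓ V⁻¹ Σ_{x ∈ B^e(y)} Σ_{s<ℓ} (B(x + (s+1)e_μ, μ) − B(x + s e_μ, μ))²`
— each line crosses the face once (`sum_fibre_faceValue_eq`), the replacement costs the line's total variation (`abs_apply_iterShift_sub_le`), then Cauchy–Schwarz
twice.  No divergence condition is used. [folklore] -/
theorem sq_lineMean_sub_faceMean_le (h : P.sitesPerDir i = P.L ^ e * P.sitesPerDir i') (B : PBond P i → ℝ) (μ : Fin P.d) (y : Site P i') :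
    ((((P.L : ℝ) ^ e) ^ P.d * (P.L : ℝ) ^ e)⁻¹
          * ∑ x ∈ univ.filter (fun x : Site P i => Site.proj i' e x = y), ∑ t ∈ range (P.L ^ e), B ⟨(fun z : Site P i => z.shift μ)^[t] x, μ⟩
        - (P.L : ℝ) ^ e * (((P.L : ℝ) ^ e) ^ P.d)⁻¹
          * ∑ x ∈ univ.filter (fun x : Site P i => Site.proj i' e x = y ∧ (x μ).val % P.L ^ e + 1 = P.L ^ e), B ⟨x, μ⟩) ^ 2
      ≤ (P.L : ℝ) ^ e * (((P.L : ℝ) ^ e) ^ P.d)⁻¹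
          * ∑ x ∈ univ.filter (fun x : Site P i => Site.proj i' e x = y), ∑ s ∈ range (P.L ^ e),
              (B ⟨((fun z : Site P i => z.shift μ)^[s] x).shift μ, μ⟩ - B ⟨(fun z : Site P i => z.shift μ)^[s] x, μ⟩) ^ 2 := by
  classical
  have hℓ : (0 : ℝ) < (P.L : ℝ) ^ e := pow_pos (by exact_mod_cast P.L_pos) e
  have hV : (0 : ℝ) < ((P.L : ℝ) ^ e) ^ P.d := pow_pos hℓ _
  have hℓnat : ((P.L ^ e : ℕ) : ℝ) = (P.L : ℝ) ^ e := by push_cast; ring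
  set f : Site P i → ℝ := fun x => B ⟨x, μ⟩ with hf
  set τ : Site P i → Site P i := fun z : Site P i => z.shift μ with hτ
  set fib := univ.filter (fun x : Site P i => Site.proj i' e x = y) with hfib
  have hcard : (fib.card : ℝ) = ((P.L : ℝ) ^ e) ^ P.d := by
    rw [hfib, Site.card_fibre h y]; push_cast; ring
  -- (P) each line crosses the face once
  have hP := sum_fibre_faceValue_eq h μ y f
  -- the difference `A − ℓ² FS` as a sum of replacements along the lines
  have hdiff : ∑ x ∈ fib, ∑ t ∈ range (P.L ^ e), f (τ^[t] x)
        - ((P.L : ℝ) ^ e) ^ 2 * ∑ x ∈ univ.filter (fun x : Site P i => Site.proj i' e x = y ∧ (x μ).val % P.L ^ e + 1 = P.L ^ e), f x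
      = ∑ x ∈ fib, ∑ t ∈ range (P.L ^ e), (f (τ^[t] x) - f (τ^[P.L ^ e - 1 - (x μ).val % P.L ^ e] x)) := by
    rw [pow_two, mul_assoc, ← hP, Finset.mul_sum, ← Finset.sum_sub_distrib]
    refine Finset.sum_congr rfl fun x _ => ?_
    rw [Finset.sum_sub_distrib, Finset.sum_const, card_range, nsmul_eq_mul, hℓnat]
  -- |A − ℓ² FS| ≤ ℓ · G
  have hAG : |∑ x ∈ fib, ∑ t ∈ range (P.L ^ e), f (τ^[t] x)
        - ((P.L : ℝ) ^ e) ^ 2 * ∑ x ∈ univ.filter (fun x : Site P i => Site.proj i' e x = y ∧ (x μ).val % P.L ^ e + 1 = P.L ^ e), f x|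
      ≤ (P.L : ℝ) ^ e * ∑ x ∈ fib, ∑ s ∈ range (P.L ^ e), |f ((τ^[s] x).shift μ) - f (τ^[s] x)| := by
    rw [hdiff]
    calc |∑ x ∈ fib, ∑ t ∈ range (P.L ^ e), (f (τ^[t] x) - f (τ^[P.L ^ e - 1 - (x μ).val % P.L ^ e] x))|
        ≤ ∑ x ∈ fib, |∑ t ∈ range (P.L ^ e), (f (τ^[t] x) - f (τ^[P.L ^ e - 1 - (x μ).val % P.L ^ e] x))| := abs_sum_le_sum_abs _ _
      _ ≤ ∑ x ∈ fib, ∑ t ∈ range (P.L ^ e), |f (τ^[t] x) - f (τ^[P.L ^ e - 1 - (x μ).val % P.L ^ e] x)| :=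
          Finset.sum_le_sum fun x _ => abs_sum_le_sum_abs _ _
      _ ≤ ∑ x ∈ fib, ∑ t ∈ range (P.L ^ e), ∑ s ∈ range (P.L ^ e), |f ((τ^[s] x).shift μ) - f (τ^[s] x)| :=
          Finset.sum_le_sum fun x _ => Finset.sum_le_sum fun t ht =>
            abs_apply_iterShift_sub_le μ f x (mem_range.1 ht).le ((Nat.sub_le _ _).trans (Nat.sub_le _ _))
      _ = (P.L : ℝ) ^ e * ∑ x ∈ fib, ∑ s ∈ range (P.L ^ e), |f ((τ^[s] x).shift μ) - f (τ^[s] x)| := by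
          rw [Finset.mul_sum]
          refine Finset.sum_congr rfl fun x _ => ?_
          rw [Finset.sum_const, card_range, nsmul_eq_mul, hℓnat]
  -- G² ≤ V·ℓ·S (Cauchy–Schwarz twice)
  have hG : (∑ x ∈ fib, ∑ s ∈ range (P.L ^ e), |f ((τ^[s] x).shift μ) - f (τ^[s] x)|) ^ 2
      ≤ ((P.L : ℝ) ^ e) ^ P.d * (P.L : ℝ) ^ e * ∑ x ∈ fib, ∑ s ∈ range (P.L ^ e), (f ((τ^[s] x).shift μ) - f (τ^[s] x)) ^ 2 := by
    have h1 := sq_sum_le_card_mul_sum_sq (s := fib) (f := fun x => ∑ s ∈ range (P.L ^ e), |f ((τ^[s] x).shift μ) - f (τ^[s] x)|)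
    have h2 : ∀ x : Site P i, (∑ s ∈ range (P.L ^ e), |f ((τ^[s] x).shift μ) - f (τ^[s] x)|) ^ 2
        ≤ (P.L : ℝ) ^ e * ∑ s ∈ range (P.L ^ e), (f ((τ^[s] x).shift μ) - f (τ^[s] x)) ^ 2 := by
      intro x
      have h3 := sq_sum_le_card_mul_sum_sq (s := range (P.L ^ e)) (f := fun s => |f ((τ^[s] x).shift μ) - f (τ^[s] x)|)
      rw [card_range, hℓnat] at h3
      simpa only [sq_abs] using h3
    rw [hcard] at h1
    calc _ ≤ ((P.L : ℝ) ^ e) ^ P.d * ∑ x ∈ fib, (∑ s ∈ range (P.L ^ e), |f ((τ^[s] x).shift μ) - f (τ^[s] x)|) ^ 2 := h1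
      _ ≤ ((P.L : ℝ) ^ e) ^ P.d * ∑ x ∈ fib, ((P.L : ℝ) ^ e * ∑ s ∈ range (P.L ^ e), (f ((τ^[s] x).shift μ) - f (τ^[s] x)) ^ 2) :=
          mul_le_mul_of_nonneg_left (Finset.sum_le_sum fun x _ => h2 x) hV.le
      _ = _ := by rw [← Finset.mul_sum, mul_assoc]
  exact sq_lineMean_sub_faceMean_le_aux hV hℓ hAG hG

/-- ★★ **N5 (iii), SUMMED OVER THE COARSE BONDS**: `Σ_c ((M_eB)(c) − ℓ^{1−d}·FS B c)² ≤ ℓ^{2−d} · Σ_μ Σ_x (B(x + e_μ, μ) − B(x, μ))²` (`ℓ = L^e`) — the error of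
replacing the straight-line block mean by the face mean is controlled by the `μ`-DIFFERENCES of `B` alone, uniformly in the volume; at `d = 3` the factor is
`ℓ^{−1}`, which is what N7 spends against `ℓ³`. [folklore] -/
theorem sum_sq_lineMean_sub_faceMean_le (h : P.sitesPerDir i = P.L ^ e * P.sitesPerDir i') (B : PBond P i → ℝ) :
    ∑ c : PBond P i',
        ((((P.L : ℝ) ^ e) ^ P.d * (P.L : ℝ) ^ e)⁻¹
            * ∑ x ∈ univ.filter (fun x : Site P i => Site.proj i' e x = c.src), ∑ t ∈ range (P.L ^ e),
                B ⟨(fun z : Site P i => z.shift c.dir)^[t] x, c.dir⟩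
          - (P.L : ℝ) ^ e * (((P.L : ℝ) ^ e) ^ P.d)⁻¹
            * ∑ x ∈ univ.filter (fun x : Site P i => Site.proj i' e x = c.src ∧ (x c.dir).val % P.L ^ e + 1 = P.L ^ e), B ⟨x, c.dir⟩) ^ 2
      ≤ ((P.L : ℝ) ^ e) ^ 2 * (((P.L : ℝ) ^ e) ^ P.d)⁻¹
          * ∑ μ : Fin P.d, ∑ x : Site P i, (B ⟨x.shift μ, μ⟩ - B ⟨x, μ⟩) ^ 2 := by
  classical
  have hℓnat : ((P.L ^ e : ℕ) : ℝ) = (P.L : ℝ) ^ e := by push_cast; ring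
  rw [sum_pbond, Finset.sum_comm]
  calc ∑ μ : Fin P.d, ∑ y : Site P i',
        ((((P.L : ℝ) ^ e) ^ P.d * (P.L : ℝ) ^ e)⁻¹
            * ∑ x ∈ univ.filter (fun x : Site P i => Site.proj i' e x = y), ∑ t ∈ range (P.L ^ e),
                B ⟨(fun z : Site P i => z.shift μ)^[t] x, μ⟩
          - (P.L : ℝ) ^ e * (((P.L : ℝ) ^ e) ^ P.d)⁻¹
            * ∑ x ∈ univ.filter (fun x : Site P i => Site.proj i' e x = y ∧ (x μ).val % P.L ^ e + 1 = P.L ^ e), B ⟨x, μ⟩) ^ 2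
      ≤ ∑ μ : Fin P.d, ∑ y : Site P i', (P.L : ℝ) ^ e * (((P.L : ℝ) ^ e) ^ P.d)⁻¹
          * ∑ x ∈ univ.filter (fun x : Site P i => Site.proj i' e x = y), ∑ s ∈ range (P.L ^ e),
              (B ⟨((fun z : Site P i => z.shift μ)^[s] x).shift μ, μ⟩ - B ⟨(fun z : Site P i => z.shift μ)^[s] x, μ⟩) ^ 2 :=
        Finset.sum_le_sum fun μ _ => Finset.sum_le_sum fun y _ => sq_lineMean_sub_faceMean_le h B μ y
    _ = (P.L : ℝ) ^ e * (((P.L : ℝ) ^ e) ^ P.d)⁻¹ * ∑ μ : Fin P.d, ∑ s ∈ range (P.L ^ e), ∑ x : Site P i,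
              (B ⟨((fun z : Site P i => z.shift μ)^[s] x).shift μ, μ⟩ - B ⟨(fun z : Site P i => z.shift μ)^[s] x, μ⟩) ^ 2 := by
        rw [Finset.mul_sum]
        refine Finset.sum_congr rfl fun μ _ => ?_
        rw [← Finset.mul_sum, Finset.sum_fiberwise (s := (univ : Finset (Site P i))) (g := Site.proj i' e)
          (f := fun x : Site P i => ∑ s ∈ range (P.L ^ e),
            (B ⟨((fun z : Site P i => z.shift μ)^[s] x).shift μ, μ⟩ - B ⟨(fun z : Site P i => z.shift μ)^[s] x, μ⟩) ^ 2),
          Finset.sum_comm]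
    _ = (P.L : ℝ) ^ e * (((P.L : ℝ) ^ e) ^ P.d)⁻¹ * ∑ μ : Fin P.d, ∑ s ∈ range (P.L ^ e), ∑ x : Site P i,
              (B ⟨x.shift μ, μ⟩ - B ⟨x, μ⟩) ^ 2 := by
        congr 1
        refine Finset.sum_congr rfl fun μ _ => Finset.sum_congr rfl fun s _ => ?_
        exact sum_iterShift μ (fun x : Site P i => (B ⟨x.shift μ, μ⟩ - B ⟨x, μ⟩) ^ 2) s
    _ = ((P.L : ℝ) ^ e) ^ 2 * (((P.L : ℝ) ^ e) ^ P.d)⁻¹ * ∑ μ : Fin P.d, ∑ x : Site P i, (B ⟨x.shift μ, μ⟩ - B ⟨x, μ⟩) ^ 2 := by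
        simp only [Finset.sum_const, card_range, nsmul_eq_mul, hℓnat, Finset.mul_sum]
        refine Finset.sum_congr rfl fun μ _ => Finset.sum_congr rfl fun x _ => ?_
        ring

end Summit.QuantumFields.YangMills.Theorems.Prop7FaceFluxLineMean

end
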